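import Mathlib
import HarnessLib
import Summits.HubbardSuperconductivity.HubbardSuperconductivity.Theorems.KLProgrammeKLRegimeSplitPhValueModuli
import Summits.HubbardSuperconductivity.HubbardSuperconductivity.Theorems.KLProgrammeKLRegimeSplitPhValueExchangeShifts

/-!
# Route `KLProgramme` — ENGINE (stmt-HubbardSuperconductivity-20437 `KLRegimeEngineV17F2`), row (c) binder #8 (★ v19 `hexLadMV`), value rows `RP` / `RQ`:
# THE SIGN-BLIND BRANCH — both rows against the born mass `2¹⁰·15367` times the SUP of the kernel product, no rotation, no reference field
# (cell gate-hubbard-kl, seat hubbard-kl-k3c2-p2 g32, technique «thermal-bar induction n ≤ nScales β + 1 with EngineBoundsAtV4S sums»; brick O6j, corollary of O6e / O6g / O6h-a)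

WHY.  The θ-resolved rotation kit (O6e′/O6e″/O6i, O6h-e, O6f′) is the tool for the deep members `j ≫ n`; in the LAST THREE SCALES below the thermal layer
(`n > nScales β − 2`, where the thermal smallness `(Λ(t) + 2π/β)/β` is no gain) and for the by-value screens of the two hands, the consumer wants the plain
SIGN-BLIND bound of the two value rows by name: hard line `|Ẇ_t|‖ĝ‖ ≤ (128/3)/Λ(t)²` at EVERY label (`abs_derivWeight_mul_norm_propCT_le`), soft sum
`Σ_p |Φ_j(t)(p)|‖ĝ_p‖ ≤ 15367·Λₙ·βL²` on an admissible frame (`sum_softSymbol_mul_norm_propCT_le_of_frameOK`), slice ratio `(Λₙ−Λₙ₊₁)Λₙ/Λ(t)² ≤ 12`.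

* **`klph_phValue_row_signBlind_le`** (RP, zero transfer, diagonal `k′ = k`): for any `W : FreqMomentum → Fin 2 → ℂ` with `‖W p σ‖ ≤ F` wherever `Ẇ_t(p) ≠ 0`,
  `(Λₙ−Λₙ₊₁)((βL²)³)⁻¹‖Σ_pΣ_σ(Ẇ_tβL²ĝ)(Φ_jβL²ĝ)·W p σ‖ ≤ 2¹⁰·15367·F` — O6e `klph_phValue_row_moduli_le` at `V₀ = 0`.
* **`klph_exchangeRow_diag_signBlind_le`** (RQ, exchange diagonal `Qm = x + y`): for any `F : FreqMomentum → FreqMomentum → ℂ` with `‖F p p′‖ ≤ F∞`,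
  `(Λₙ−Λₙ₊₁)((βL²)³)⁻¹‖Σ_pΣ_{p′}[p′ = p shifted by 2ω₀+1, same momentum]((Φ_jβL²ĝ)(p)(Ẇ_tβL²ĝ)(p′) + (Ẇ_tβL²ĝ)(p)(Φ_jβL²ĝ)(p′))·F p p′‖ ≤ 2¹⁰·15367·F∞` —
  O6g `klph_exchangeRow_diag_eq` collapses the partner sum onto `p′ = p⁻`; the second ordering is reindexed onto the hard label with O6h-a `klph_sum_shift_reindex`
  (`Σ_p[p ≠ bottom]‖soft p⁻‖ = Σ_q[q ≠ top]‖soft q‖ ≤ Σ_q‖soft q‖`); NO boundary / size hypothesis on `M` is needed (nothing is shifted inside a propagator).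
By value (E1-LEDGER rev 16, both hands): `F, F∞ ≍ (c₄U)²` by (E.2), so both rows are `≤ 2¹⁰·15367·(c₄U)²` per member per slice — the currency of the last three
scales and of line #8's thermal-layer words; the deep members use the rotation kit instead.  Pure composition; no definitions; nothing asserts (c), K3 or
superconductivity.  [cite: BenfattoGiulianiMastropietro2006, §2.4–§2.5]
-/

noncomputable section

namespace Summit.HubbardSuperconductivity.HubbardSuperconductivity.Theorems.KLRegimeSplit

set_option linter.dupNamespace false -- summit = problem name (single-conjunct summit), D-0017

open Real Set Finset Literature.MathematicalPhysics.QuantumLattice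
open Literature.Probability.LatticeModels hiding torusSupNorm
open Literature.MathematicalPhysics.QuantumLattice.BandSectorCounting
open Summit.HubbardSuperconductivity.HubbardSuperconductivity.Theorems.TwoPointAssembly
open Summit.HubbardSuperconductivity.HubbardSuperconductivity.Theorems.KLProgrammeLegKernels
open Summit.HubbardSuperconductivity.HubbardSuperconductivity.Theorems.KLRegimeWick
open Summit.HubbardSuperconductivity.HubbardSuperconductivity.Theorems.EngineV8
open Summit.HubbardSuperconductivity.HubbardSuperconductivity.Theorems.DispersionFlow
open Summit.HubbardSuperconductivity.HubbardSuperconductivity.Theorems.PerturbedFermiCurve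

variable {L M : ℕ} [NeZero L] [NeZero M]

/-! ## §1 RP: the direct value row, sign-blind -/

section Direct

variable {R : RenConsts} {U : ℝ} {N : ℕ}

omit [NeZero M] in
/-- **RP SIGN-BLIND.**  On an admissible frame (`FrameOK`), `klBetaMin ≤ β ≤ L`, member `j ≥ n+1`, `t ∈ [0,1]`: for any kernel product `W : FreqMomentum → Fin 2 → ℂ`
with `‖W p σ‖ ≤ F` wherever the hard line lives (`Ẇ_t(p) ≠ 0`), `(Λₙ−Λₙ₊₁)((βL²)³)⁻¹‖Σ_pΣ_σ(Ẇ_tβL²ĝ)(Φ_jβL²ĝ)·W p σ‖ ≤ 2¹⁰·15367·F`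
(O6e `klph_phValue_row_moduli_le` with the reference field `V₀ = 0`).  [cite: BenfattoGiulianiMastropietro2006, §2.4–§2.5] -/
theorem klph_phValue_row_signBlind_le {β μ : ℝ} {K : TrigPolyC4v} (hK : FrameOK R U N μ K) (hβ : klBetaMin ≤ β) (hβL : β ≤ L) (n : ℕ) {t : ℝ}
    (ht : t ∈ Icc (0 : ℝ) 1)
    (Φ : ℕ → ℝ → FreqMomentum L M → ℝ)
    (hΦ : Φ = fun j t k => (softSymbolCompl L M β μ K (n + 1) j) k + (hubbardCutoffWeightCT L M β μ K (klScale klE0 (n + 1)) k -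
        hubbardCutoffWeightCT L M β μ K (klScale klE0 n + t * (klScale klE0 (n + 1) - klScale klE0 n)) k))
    (Wd : ℝ → FreqMomentum L M → ℝ)
    (hWd : Wd = fun t k => deriv (fun Λ' : ℝ => hubbardCutoffWeightCT L M β μ K Λ' k) (klScale klE0 n + t * (klScale klE0 (n + 1) - klScale klE0 n)))
    {j : ℕ} (hj : n + 1 ≤ j) (W : FreqMomentum L M → Fin 2 → ℂ) {F : ℝ} (hF0 : 0 ≤ F)
    (hF : ∀ p : FreqMomentum L M, ∀ σ : Fin 2, Wd t p ≠ 0 → ‖W p σ‖ ≤ F) :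
    (klScale klE0 n - klScale klE0 (n + 1)) * ((β * (L : ℝ) ^ 2) ^ 3)⁻¹ *
        ‖∑ p : FreqMomentum L M, ∑ σ : Fin 2,
          (((((Wd t p) : ℝ) : ℂ) * (((β * (L : ℝ) ^ 2 : ℝ) : ℂ) * propCT L M β μ K p)) * ((((Φ j t p) : ℝ) : ℂ) * (((β * (L : ℝ) ^ 2 : ℝ) : ℂ) * propCT L M β μ K p))) *
            W p σ‖ ≤ (2 : ℝ) ^ 10 * 15367 * F := by
  have h := klph_phValue_row_moduli_le (L := L) (M := M) hK hβ hβL n ht Φ hΦ Wd hWd hj W 0 hF0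
    (fun p σ hp => by simpa only [Pi.zero_apply, sub_zero] using hF p σ hp)
  simpa only [Pi.zero_apply, mul_zero, sum_const_zero, norm_zero, zero_add] using h

end Direct

/-! ## §2 RQ: the exchange value row, sign-blind -/

section Exchange

variable {R : RenConsts} {U : ℝ} {N : ℕ}

omit [NeZero L] [NeZero M] in
/-- Slice arithmetic: `(Λₙ − Λₙ₊₁)·Λₙ/Λ(t)² ≤ 12` for `Λ(t) ∈ [Λₙ₊₁, Λₙ]`, `Λₙ₊₁ = Λₙ/4`. -/
private theorem klph_slice_ratio_le' (n : ℕ) {t : ℝ} (ht : t ∈ Icc (0 : ℝ) 1) :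
    (klScale klE0 n - klScale klE0 (n + 1)) * klScale klE0 n / (klScale klE0 n + t * (klScale klE0 (n + 1) - klScale klE0 n)) ^ 2 ≤ 12 := by
  have h10 := (klmf_klScale_succ_pos_le n).2
  have h1 := (klmf_klScale_succ_pos_le n).1
  have hΛn : 0 < klScale klE0 n := klth_klScale_pos n
  have hsucc : klScale klE0 (n + 1) = klScale klE0 n / 4 := klth_klScale_succ n
  have hmem := klws_affine_mem_Icc h10 ht
  calc (klScale klE0 n - klScale klE0 (n + 1)) * klScale klE0 n / (klScale klE0 n + t * (klScale klE0 (n + 1) - klScale klE0 n)) ^ 2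
      ≤ (klScale klE0 n - klScale klE0 (n + 1)) * klScale klE0 n / (klScale klE0 (n + 1)) ^ 2 :=
        div_le_div_of_nonneg_left (by nlinarith) (by positivity) (pow_le_pow_left₀ h1.le hmem.1 2)
    _ = 12 := by rw [hsucc]; field_simp; ring

/-- Reindexing a REAL sum over the down-shifted labels onto the shifted label: `Σ_p [p ≠ bottom]·f p⁻ = Σ_q [q ≠ top]·f q` (O6h-a `klph_sum_shift_reindex`). -/
theorem klph_sum_shift_reindex_real {σ τ : MatsubaraIdx M → MatsubaraIdx M}
    (hσ : ∀ ν : MatsubaraIdx M, (ν : ℕ) ≠ 0 → matsubaraInt M (σ ν) = matsubaraInt M ν - 1)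
    (hτ : ∀ ν : MatsubaraIdx M, (ν : ℕ) ≠ 2 * M - 1 → matsubaraInt M (τ ν) = matsubaraInt M ν + 1) (f : FreqMomentum L M → ℝ) :
    (∑ p : FreqMomentum L M, if (p.1 : ℕ) = 0 then (0 : ℝ) else f (σ p.1, p.2)) =
      ∑ q : FreqMomentum L M, if (q.1 : ℕ) = 2 * M - 1 then (0 : ℝ) else f q := by
  have hre := klph_sum_shift_reindex (L := L) hσ hτ (fun _ q => ((f q : ℝ) : ℂ))
  have h2 := congrArg Complex.re hre
  simpa only [Complex.re_sum, apply_ite Complex.re, Complex.zero_re, Complex.ofReal_re] using h2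

/-- **RQ SIGN-BLIND.**  On an admissible frame (`FrameOK`), `klBetaMin ≤ β ≤ L`, member `j ≥ n+1`, `t ∈ [0,1]`, with the Matsubara down/up shifts `σ`/`τ` (O6g
`klph_exists_shiftIdx`, O6h-a `klph_exists_upShiftIdx`): for any partner kernel `F : FreqMomentum → FreqMomentum → ℂ` with `‖F p p′‖ ≤ F∞`, the exchange p-h value
row at the exchange diagonal `Qm = x + y` obeys `(Λₙ−Λₙ₊₁)((βL²)³)⁻¹‖Σ_pΣ_{p′}[…]((Φ_jβL²ĝ)(p)(Ẇ_tβL²ĝ)(p′) + (Ẇ_tβL²ĝ)(p)(Φ_jβL²ĝ)(p′))·F p p′‖ ≤ 2¹⁰·15367·F∞`: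
both orderings cost the born mass `2⁹·15367` (hard sup × soft sum × slice ratio), the second after reindexing onto the hard label.  No hypothesis on `M`.
[cite: BenfattoGiulianiMastropietro2006, §2.4–§2.5] -/
theorem klph_exchangeRow_diag_signBlind_le {β μ : ℝ} {K : TrigPolyC4v} (hK : FrameOK R U N μ K) (hβ : klBetaMin ≤ β) (hβL : β ≤ L)
    (n : ℕ) {t : ℝ} (ht : t ∈ Icc (0 : ℝ) 1)
    (Φ : ℕ → ℝ → FreqMomentum L M → ℝ) (hΦ : Φ = fun j t k => (softSymbolCompl L M β μ K (n + 1) j) k + (hubbardCutoffWeightCT L M β μ K (klScale klE0 (n + 1)) k -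
            hubbardCutoffWeightCT L M β μ K (klScale klE0 n + t * (klScale klE0 (n + 1) - klScale klE0 n)) k))
    (Wd : ℝ → FreqMomentum L M → ℝ) (hWd : Wd = fun t k => deriv (fun Λ' : ℝ => hubbardCutoffWeightCT L M β μ K Λ' k) (klScale klE0 n + t * (klScale klE0 (n + 1) - klScale klE0 n)))
    {j : ℕ} (hj : n + 1 ≤ j)
    {σ τ : MatsubaraIdx M → MatsubaraIdx M}
    (hσ : ∀ ν : MatsubaraIdx M, (ν : ℕ) ≠ 0 → matsubaraInt M (σ ν) = matsubaraInt M ν - 1)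
    (hτ : ∀ ν : MatsubaraIdx M, (ν : ℕ) ≠ 2 * M - 1 → matsubaraInt M (τ ν) = matsubaraInt M ν + 1)
    (F : FreqMomentum L M → FreqMomentum L M → ℂ) {Finf : ℝ} (hF0 : 0 ≤ Finf) (hF : ∀ p p' : FreqMomentum L M, ‖F p p'‖ ≤ Finf)
    {Qm x y : TorusSite 2 L} (hxy : Qm = x + y) :
    (klScale klE0 n - klScale klE0 (n + 1)) * ((β * (L : ℝ) ^ 2) ^ 3)⁻¹ *
      ‖∑ p : FreqMomentum L M, ∑ p' : FreqMomentum L M,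
        (if matsubaraInt M p'.1 + matsubaraInt M (omega0 M) + matsubaraInt M (omega0 M) + 1 = matsubaraInt M p.1 ∧ p'.2 = p.2 + Qm - x - y then
          (((((Φ j t p) : ℝ) : ℂ) * (((β * (L : ℝ) ^ 2 : ℝ) : ℂ) * propCT L M β μ K p)) * ((((Wd t p') : ℝ) : ℂ) * (((β * (L : ℝ) ^ 2 : ℝ) : ℂ) * propCT L M β μ K p')) +
            ((((Wd t p) : ℝ) : ℂ) * (((β * (L : ℝ) ^ 2 : ℝ) : ℂ) * propCT L M β μ K p)) * ((((Φ j t p') : ℝ) : ℂ) * (((β * (L : ℝ) ^ 2 : ℝ) : ℂ) * propCT L M β μ K p'))) *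
            F p p'
        else 0)‖ ≤ (2 : ℝ) ^ 10 * 15367 * Finf := by
  classical
  have hβ0 : 0 < β := pos_of_klBetaMin_le hβ
  have hL : (0 : ℝ) < L := hβ0.trans_le hβL
  have hβL2 : 0 < β * (L : ℝ) ^ 2 := by positivity
  have hΛn : 0 < klScale klE0 n := klth_klScale_pos n
  have h10 := (klmf_klScale_succ_pos_le n).2
  have h1 := (klmf_klScale_succ_pos_le n).1
  have hmem := klws_affine_mem_Icc h10 ht
  set Λt : ℝ := klScale klE0 n + t * (klScale klE0 (n + 1) - klScale klE0 n) with hΛt_def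
  have hΛt : 0 < Λt := h1.trans_le hmem.1
  have hdiff : 0 ≤ klScale klE0 n - klScale klE0 (n + 1) := by linarith
  have hC : 0 ≤ (klScale klE0 n - klScale klE0 (n + 1)) * ((β * (L : ℝ) ^ 2) ^ 3)⁻¹ := by positivity
  -- the two lines as functions of the label
  set hard : FreqMomentum L M → ℂ := fun p => (((Wd t p) : ℝ) : ℂ) * (((β * (L : ℝ) ^ 2 : ℝ) : ℂ) * propCT L M β μ K p) with hhard_def
  set soft : FreqMomentum L M → ℂ := fun p => (((Φ j t p) : ℝ) : ℂ) * (((β * (L : ℝ) ^ 2 : ℝ) : ℂ) * propCT L M β μ K p) with hsoft_def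
  have hn : ‖(((β * (L : ℝ) ^ 2 : ℝ) : ℂ))‖ = β * (L : ℝ) ^ 2 := by rw [Complex.norm_real, Real.norm_of_nonneg hβL2.le]
  -- the hard line at EVERY label
  have hH : ∀ p : FreqMomentum L M, ‖hard p‖ ≤ β * (L : ℝ) ^ 2 * (128 / 3 / Λt ^ 2) := by
    intro p
    have h : |Wd t p| * ‖propCT L M β μ K p‖ ≤ 128 / 3 / Λt ^ 2 := by
      rw [hWd]; exact abs_derivWeight_mul_norm_propCT_le β μ K hΛt p
    have hp' : hard p = (((Wd t p) : ℝ) : ℂ) * (((β * (L : ℝ) ^ 2 : ℝ) : ℂ) * propCT L M β μ K p) := rfl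
    rw [hp', norm_mul, norm_mul, hn, Complex.norm_real, Real.norm_eq_abs]
    calc |Wd t p| * (β * (L : ℝ) ^ 2 * ‖propCT L M β μ K p‖) = β * (L : ℝ) ^ 2 * (|Wd t p| * ‖propCT L M β μ K p‖) := by ring
      _ ≤ β * (L : ℝ) ^ 2 * (128 / 3 / Λt ^ 2) := mul_le_mul_of_nonneg_left h hβL2.le
  -- the soft line's norm and its sum
  have hsoftn : ∀ p : FreqMomentum L M, ‖soft p‖ = β * (L : ℝ) ^ 2 * (|Φ j t p| * ‖propCT L M β μ K p‖) := by
    intro p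
    have hp' : soft p = (((Φ j t p) : ℝ) : ℂ) * (((β * (L : ℝ) ^ 2 : ℝ) : ℂ) * propCT L M β μ K p) := rfl
    rw [hp', norm_mul, norm_mul, hn, Complex.norm_real, Real.norm_eq_abs]; ring
  have hΦmem : ∀ k, 0 ≤ Φ j t k ∧ Φ j t k ≤ 1 - hubbardCutoffWeightCT L M β μ K (klScale klE0 n) k := by
    intro k
    have h := klmf_runningSymbol_mem L M β μ K n (isSoftSymbol_compl (L := L) (M := M) β μ K hj).1 ht k
    rw [hΦ]; exact h
  have hS : ∑ p : FreqMomentum L M, ‖soft p‖ ≤ β * (L : ℝ) ^ 2 * (15367 * klScale klE0 n * β * (L : ℝ) ^ 2) := by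
    calc ∑ p : FreqMomentum L M, ‖soft p‖ = β * (L : ℝ) ^ 2 * ∑ k : FreqMomentum L M, |Φ j t k| * ‖propCT L M β μ K k‖ := by
          rw [Finset.mul_sum]; exact sum_congr rfl fun p _ => hsoftn p
      _ ≤ β * (L : ℝ) ^ 2 * (15367 * klScale klE0 n * β * (L : ℝ) ^ 2) :=
          mul_le_mul_of_nonneg_left (sum_softSymbol_mul_norm_propCT_le_of_frameOK β μ K hK hβ hβL n hΦmem) hβL2.le
  -- the reindexed soft sum
  have hS' : (∑ p : FreqMomentum L M, if (p.1 : ℕ) = 0 then (0 : ℝ) else ‖soft (σ p.1, p.2)‖) ≤ ∑ q : FreqMomentum L M, ‖soft q‖ := by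
    rw [klph_sum_shift_reindex_real (L := L) hσ hτ (fun q => ‖soft q‖)]
    refine sum_le_sum fun q _ => ?_
    split_ifs
    · exact norm_nonneg _
    · exact le_rfl
  -- Step 1: collapse the partner sum
  rw [klph_exchangeRow_diag_eq (L := L) hσ β μ K (Φ j t) (Wd t) F hxy]
  have hgoal : (∑ p : FreqMomentum L M, if (p.1 : ℕ) = 0 then 0 else
        (((((Φ j t p) : ℝ) : ℂ) * (((β * (L : ℝ) ^ 2 : ℝ) : ℂ) * propCT L M β μ K p)) *
              ((((Wd t (σ p.1, p.2)) : ℝ) : ℂ) * (((β * (L : ℝ) ^ 2 : ℝ) : ℂ) * propCT L M β μ K (σ p.1, p.2))) +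
            ((((Wd t p) : ℝ) : ℂ) * (((β * (L : ℝ) ^ 2 : ℝ) : ℂ) * propCT L M β μ K p)) *
              ((((Φ j t (σ p.1, p.2)) : ℝ) : ℂ) * (((β * (L : ℝ) ^ 2 : ℝ) : ℂ) * propCT L M β μ K (σ p.1, p.2)))) *
          F p (σ p.1, p.2)) =
      ∑ p : FreqMomentum L M, if (p.1 : ℕ) = 0 then 0 else (soft p * hard (σ p.1, p.2) + hard p * soft (σ p.1, p.2)) * F p (σ p.1, p.2) := by
    rfl
  rw [hgoal]
  -- Step 2: pointwise sign-blind bound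
  set H0 : ℝ := β * (L : ℝ) ^ 2 * (128 / 3 / Λt ^ 2) with hH0_def
  have hH00 : 0 ≤ H0 := by positivity
  have hpt : ∀ p : FreqMomentum L M,
      ‖(if (p.1 : ℕ) = 0 then 0 else (soft p * hard (σ p.1, p.2) + hard p * soft (σ p.1, p.2)) * F p (σ p.1, p.2))‖ ≤
        H0 * Finf * ‖soft p‖ + H0 * Finf * (if (p.1 : ℕ) = 0 then (0 : ℝ) else ‖soft (σ p.1, p.2)‖) := by
    intro p
    by_cases hp : (p.1 : ℕ) = 0
    · rw [if_pos hp, if_pos hp, norm_zero, mul_zero, add_zero]; positivity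
    · rw [if_neg hp, if_neg hp, norm_mul]
      have hA : ‖soft p * hard (σ p.1, p.2)‖ ≤ ‖soft p‖ * H0 := by
        rw [norm_mul]; exact mul_le_mul_of_nonneg_left (hH _) (norm_nonneg _)
      have hB : ‖hard p * soft (σ p.1, p.2)‖ ≤ H0 * ‖soft (σ p.1, p.2)‖ := by
        rw [norm_mul]; exact mul_le_mul_of_nonneg_right (hH _) (norm_nonneg _)
      have hsum : ‖soft p * hard (σ p.1, p.2) + hard p * soft (σ p.1, p.2)‖ ≤ ‖soft p‖ * H0 + H0 * ‖soft (σ p.1, p.2)‖ :=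
        (norm_add_le _ _).trans (add_le_add hA hB)
      calc ‖soft p * hard (σ p.1, p.2) + hard p * soft (σ p.1, p.2)‖ * ‖F p (σ p.1, p.2)‖
          ≤ (‖soft p‖ * H0 + H0 * ‖soft (σ p.1, p.2)‖) * Finf := mul_le_mul hsum (hF _ _) (norm_nonneg _) (by positivity)
        _ = H0 * Finf * ‖soft p‖ + H0 * Finf * ‖soft (σ p.1, p.2)‖ := by ring
  have htot : ‖∑ p : FreqMomentum L M, (if (p.1 : ℕ) = 0 then 0 else (soft p * hard (σ p.1, p.2) + hard p * soft (σ p.1, p.2)) * F p (σ p.1, p.2))‖ ≤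
      2 * (H0 * Finf) * (β * (L : ℝ) ^ 2 * (15367 * klScale klE0 n * β * (L : ℝ) ^ 2)) := by
    calc ‖∑ p : FreqMomentum L M, (if (p.1 : ℕ) = 0 then 0 else (soft p * hard (σ p.1, p.2) + hard p * soft (σ p.1, p.2)) * F p (σ p.1, p.2))‖
        ≤ ∑ p : FreqMomentum L M, ‖(if (p.1 : ℕ) = 0 then 0 else (soft p * hard (σ p.1, p.2) + hard p * soft (σ p.1, p.2)) * F p (σ p.1, p.2))‖ :=
          norm_sum_le _ _
      _ ≤ ∑ p : FreqMomentum L M, (H0 * Finf * ‖soft p‖ + H0 * Finf * (if (p.1 : ℕ) = 0 then (0 : ℝ) else ‖soft (σ p.1, p.2)‖)) :=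
          sum_le_sum fun p _ => hpt p
      _ = H0 * Finf * ∑ p : FreqMomentum L M, ‖soft p‖ +
            H0 * Finf * ∑ p : FreqMomentum L M, (if (p.1 : ℕ) = 0 then (0 : ℝ) else ‖soft (σ p.1, p.2)‖) := by
          rw [sum_add_distrib, Finset.mul_sum, Finset.mul_sum]
      _ ≤ H0 * Finf * (β * (L : ℝ) ^ 2 * (15367 * klScale klE0 n * β * (L : ℝ) ^ 2)) +
            H0 * Finf * (β * (L : ℝ) ^ 2 * (15367 * klScale klE0 n * β * (L : ℝ) ^ 2)) :=
          add_le_add (mul_le_mul_of_nonneg_left hS (by positivity)) (mul_le_mul_of_nonneg_left (hS'.trans hS) (by positivity))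
      _ = _ := by ring
  -- Step 3: the slice arithmetic
  calc (klScale klE0 n - klScale klE0 (n + 1)) * ((β * (L : ℝ) ^ 2) ^ 3)⁻¹ *
        ‖∑ p : FreqMomentum L M, (if (p.1 : ℕ) = 0 then 0 else (soft p * hard (σ p.1, p.2) + hard p * soft (σ p.1, p.2)) * F p (σ p.1, p.2))‖
      ≤ (klScale klE0 n - klScale klE0 (n + 1)) * ((β * (L : ℝ) ^ 2) ^ 3)⁻¹ *
          (2 * (H0 * Finf) * (β * (L : ℝ) ^ 2 * (15367 * klScale klE0 n * β * (L : ℝ) ^ 2))) := mul_le_mul_of_nonneg_left htot hC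
    _ = 2 * (128 / 3) * 15367 * ((klScale klE0 n - klScale klE0 (n + 1)) * klScale klE0 n / Λt ^ 2) * Finf := by
        rw [hH0_def]; field_simp
    _ ≤ 2 * (128 / 3) * 15367 * 12 * Finf := by
        have := klph_slice_ratio_le' n ht
        have h0 : (0 : ℝ) ≤ 2 * (128 / 3) * 15367 := by norm_num
        nlinarith [mul_le_mul_of_nonneg_left this h0]
    _ = (2 : ℝ) ^ 10 * 15367 * Finf := by norm_num

end Exchange

end Summit.HubbardSuperconductivity.HubbardSuperconductivity.Theorems.KLRegimeSplit

end
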